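import Mathlib
import HarnessLib
import Literature.MathematicalPhysics.QuantumFieldTheory.Balaban1983to89.B13Contraction113
import Literature.MathematicalPhysics.QuantumFieldTheory.Balaban1983to89.B12Lineariz267

/-!
# B12 [Balaban1987RG1] p. 267 — «it is an analytic function of B»: JOINT (Fréchet) analyticity of the linearizing
# `D̃` by the complex-analytic implicit function theorem, its derivative `DD̃ = (I + DC̃·h)⁻¹DC̃ = O(‖B‖)`, and the
# Jacobian `DΦ = I − h∘DD̃` of the change of variables `Φ(B) = B − hD̃(B)` (the operator under `Tr log` in (2.12))

CITATION. T. Bałaban, *Renormalization group approach to lattice gauge field theories. I. Generation of effective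
actions in a small field approximation and a coupling constant renormalization in four dimensions*, Commun. Math.
Phys. 109 (1987) 249–301 [Balaban1987RG1] ("B12" of the cell), p. 267 and (2.12) p. 268 (renders
`…1987-cmp109-rg-I-small-field-p019`, `-p020`; PDF page = journal page − 248); the template [15] = T. Bałaban, *The
variational problem and background fields in renormalization group method for lattice gauge theories*, CMP 102 (1985)
277–309, Sect. C p. 286 [Balaban1985Variational] (render `…1985-cmp102-variational-background-p010`).  This file sits
on top of the tree leaf `B12Lineariz267` (the algebra of the substitution, the fixed point `D̃` BY NAME from the
contraction module `B13Contraction113` — the tree's kernel of the scheme print calls «Sect. C [15]», itself cited to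
[Balaban1988RG2Cluster] p. 5 and [15] pp. 286–287 —, the explicit inverse, analyticity ALONG COMPLEX LINES) and
supplies the item it left NOT TYPED: analyticity of `D̃` as a map of complex Banach spaces, with the derivative
formulas.  Both modules are imported and used BY NAME; nothing of them is re-derived.

THE PRINT (verbatim).  B12 p. 267 [PDF 19]: *«We are looking for an analytic, 𝐠-valued function D̃(B′), defined at
bonds of T⁽ᵏ⁺¹⁾, and such that the transformation B′ = B − hD̃(B) linearizes the function Q̃(B′). The function D̃(B)
is determined by the equation LQ̃B′ + C̃(B′) = LQ̃B − D̃(B) + C̃(B − hD̃(B)) = LQ̃B. It is easy to prove, following the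
proofs in the above mentioned papers, that there exists exactly one solution of this equation, and that it is an
analytic function of B. From this equation we obtain also that D̃(B) has an expansion beginning with quadratic terms,
and D̃⁽²⁾(B) = C̃⁽²⁾(B).»*  The consumer, p. 268 [PDF 20]: *«After these transformations we obtain the following
expression for the new action:»* (2.12), whose fluctuation integral carries under the exponential the terms *«Tr log(I − h((δ/δB)D̃)(g_kCB))»*
and *«+ log σ(g_kCB − hD̃(g_kCB))»* — `I − h(δD̃/δB)` is the derivative of the substitution `B ↦ B − hD̃(B)`, and
`Tr log` of it is the logarithm of its Jacobian determinant.  [15] p. 286 [PDF 10] (the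
template's contraction constant): *«Hence the transformation is contractive if 9C₂B₀ε₃ < 1; for example we take
9C₂B₀ε₃ ≦ 1/2, i.e. ε₃ ≦ (18C₂B₀)⁻¹»*.

THE TYPING (schematic, as in `B12Lineariz267` — cell DIVERGENCE row for this file).  `𝒴`, `𝒳` complex normed spaces
of configurations on bonds of `T⁽ᵏ⁾`, `T⁽ᵏ⁺¹⁾`; `hop : 𝒳 →ₗ[ℂ] 𝒴` (print's `h`) with `‖hop X‖ ≤ b‖X‖`; `Ct : 𝒴 → 𝒳`
(print's `C̃`) with `B13Contraction113.QuadAnalytic Ct C₂ R` (quadratic bound + line analyticity on `‖Y‖ < R`);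
`9C₂bε < 1`, `3ε ≤ R`; `D̃` HYPOTHESIS-STYLE: any `Dt : 𝒴 → 𝒳` with `Dt B ∈ closedBall 0 (4C₂ε²)` and
`Ct (B − hop (Dt B)) = Dt B` on `‖B‖ < ε` (`B12Lineariz267.exists_Dt` / `eq_Dt_of_fixedPt`).  ADDED HERE, to run
the analytic implicit function theorem: `Ct` is `AnalyticOnNhd ℂ` on `{Y : ‖Y‖ < R}` (print: C̃ is analytic — on the
finite lattice «analytic» means holomorphic on an open subset of a finite-dimensional complex space, which is this),
and BOTH `𝒳` and `𝒴` are complete (automatic on the finite lattice; Mathlib's `ContDiffAt.implicitFunction` wants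
Banach spaces).  The linear map `h` enters the derivative formulas as the continuous linear map
`hop.mkContinuous b hHop` (same values, `LinearMap.mkContinuous_apply`).

CONTENTS.  §1 [folklore] the CAUCHY ESTIMATE FOR THE FRÉCHET DERIVATIVE under the quadratic bound: for `Ct`
ℂ-differentiable on `‖Y‖ < R` with `‖Ct Y‖ ≤ C₂‖Y‖²`, `‖DC̃(Y)Z‖ ≤ C₂(‖Y‖ + ρ)²ρ⁻¹‖Z‖` whenever `‖Y‖ + ρ < R`
(Cauchy's inequality for `τ ↦ C̃(Y + τZ)` on `|τ| = ρ/‖Z‖`, Mathlib `Complex.norm_deriv_le_of_forall_mem_sphere_norm_le`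
— the device of [15] (53)–(54), applied to the derivative); hence `‖DC̃(Y)‖ ≤ 9C₂ε` on `‖Y‖ < 2ε` (`ρ = ε`),
`‖DC̃(Y)‖ ≤ 9C₂‖B‖` for `‖Y‖ ≤ 2‖B‖`, `3‖B‖ < R` (`ρ = ‖B‖`; the same estimate in ball form is the tree's
`B7Ineq148.norm_fderiv_apply_le_of_sq_bound_aux`, not imported), and the mean-value Lipschitz bound `‖C̃(Y₁) − C̃(Y₂)‖ ≤ 9C₂ε‖Y₁ − Y₂‖` on the (convex) ball `‖Y‖ < 2ε`.  §2 [folklore] `D̃` is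
LIPSCHITZ on `‖B‖ < ε` with constant `9C₂ε(1 − 9C₂bε)⁻¹` (fixed-point equation + §1 + absorption), hence continuous.
§3 [folklore] the NEUMANN SERIES in `E →L[ℂ] E` for a complex Banach space `E`: `‖A‖ ≤ q < 1 ⇒ I + A` is
`ContinuousLinearMap.IsInvertible` with `‖(I + A)⁻¹‖ ≤ (1 − q)⁻¹` (Mathlib `Units.oneSub`,
`tsum_geometric_le_of_norm_lt_one`; the tree's `BlockAveragingFederbushAnalytic.isInvertible_of_norm_sub_one_le` is
the normed-ALGEBRA case).  §4 [folklore] the COMPLEX-ANALYTIC IMPLICIT FUNCTION THEOREM (Mathlib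
`ContDiffAt.implicitFunction` at `n = ω` over `ℂ`, `contDiffAt_implicitFunction`, `hasStrictFDerivAt_implicitFunction`,
`eventually_apply_eq_iff_implicitFunction`, `ContDiffAt.analyticAt`; the pattern of the tree's
`BlockAveragingFederbushAnalytic` §A1) for `F(B, X) = X − C̃(B − hX)` at `(B₀, D̃(B₀))`, `‖B₀‖ < ε`: `F` is analytic
there (`Y₀ = B₀ − hD̃(B₀)` has `‖Y₀‖ < 2ε < R` by `B12Lineariz267.mapsTo_phi`), `∂_X F = I + DC̃(Y₀)h` with
`‖DC̃(Y₀)h‖ ≤ 9C₂bε < 1` (invertible by §3), `∂_B F = −DC̃(Y₀)`; Mathlib's implicit function agrees with `D̃` near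
`B₀` (continuity of `B ↦ (B, D̃(B))` from §2 and `F(B, D̃(B)) = 0`); CONCLUSIONS: `AnalyticAt ℂ Dt B₀`,
`AnalyticOnNhd ℂ Dt (ball 0 ε)`, `DifferentiableOn`, the strict derivative `DD̃(B₀) = (I + DC̃(Y₀)h)⁻¹ ∘ DC̃(Y₀)`,
the bounds `‖DC̃(Y₀)‖ ≤ 9C₂‖B₀‖` (since `‖hD̃(B₀)‖ ≤ 4C₂b‖B₀‖² ≤ ‖B₀‖`, `B12Lineariz267.norm_hop_Dt_le`) and
`‖DD̃(B₀)‖ ≤ 9C₂‖B₀‖(1 − 9C₂bε)⁻¹` (the derivative is `O(‖B‖)`: «expansion beginning with quadratic terms»); the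
change of variables `Φ(B) = B − hD̃(B)` is analytic on `‖B‖ < ε` with `DΦ(B₀) = I − h∘DD̃(B₀)`,
`‖h∘DD̃(B₀)‖ ≤ 9C₂b‖B₀‖(1 − 9C₂bε)⁻¹`, and — under [15]'s choice `9C₂bε ≤ 1/2` — `DΦ(B₀)` is invertible for
every `‖B₀‖ < ε` (Neumann; `‖h∘DD̃(B₀)‖ < 1`); the explicit inverse `Ψ(B′) = B′ + hC̃(B′)` is analytic on `‖B′‖ < R`.
§5 ONE transcription theorem [cite] assembling «analytic function of B» in this typing for the `D̃` of
`B12Lineariz267.p267_linearizing_change_of_variables`, and a degenerate model showing its nine hypotheses are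
jointly satisfiable.  NOT TYPED: the trace / determinant `Tr log(I − h(δD̃/δB))` itself and its bounds (finite
dimension, print's (2.12)–(2.13)), the reality / 𝐠-valuedness of `D̃` and of `DD̃` (for real data: `B12Lineariz267.
Dt_mem_of_mapsTo`), the identity of second-order Taylor coefficients `D̃⁽²⁾ = C̃⁽²⁾` as an identity of bilinear
forms (the tree has the third-order bound `B12Lineariz267.norm_Dt_sub_Ct_le` only), the sizes of the real domains.
Everything is [folklore] functional analysis except §5; nothing of [B12] is asserted; NOT summit progress.
-/

open Metric Set Filter Topology
open scoped ContDiff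

namespace Literature.MathematicalPhysics.QuantumFieldTheory.Balaban1983to89.B12LinearizAnalytic267

open Literature.MathematicalPhysics.QuantumFieldTheory.Balaban1983to89.B13Contraction113
open Literature.MathematicalPhysics.QuantumFieldTheory.Balaban1983to89.B12Lineariz267

/-! ## §1  The Cauchy estimate for the Fréchet derivative under the quadratic bound -/

section cauchy

variable {𝒳 𝒴 : Type*} [NormedAddCommGroup 𝒳] [NormedSpace ℂ 𝒳] [NormedAddCommGroup 𝒴] [NormedSpace ℂ 𝒴]
  {Ct : 𝒴 → 𝒳} {C₂ R : ℝ}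

/-- **Cauchy estimate for the Fréchet derivative of a map with a quadratic bound.**  If `C̃` is
complex-(Fréchet-)differentiable on `‖Y‖ < R` with `‖C̃(Y)‖ ≤ C₂‖Y‖²` there (`C₂ ≥ 0`), then for every `ρ > 0`
with `‖Y‖ + ρ < R`: `‖DC̃(Y)·Z‖ ≤ C₂(‖Y‖ + ρ)²ρ⁻¹‖Z‖` — Cauchy's estimate for `τ ↦ C̃(Y + τZ)` on the circle
`|τ| = ρ/‖Z‖` (the device of [15] (53)–(54) p. 286, applied to the derivative instead of a difference).  The
tree's `B7Ineq148.norm_fderiv_apply_le_of_sq_bound_aux` is the same estimate in `Metric.ball 0 R` form with the disc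
radius as parameter; it is restated here over `{Y | ‖Y‖ < R}` (the form of `B13Contraction113.QuadAnalytic.quad`)
with the `𝒴`-radius `ρ` as parameter, keeping this module's imports inside the cell's staged package. [folklore] -/
theorem norm_fderiv_apply_le_of_quad (hCd : DifferentiableOn ℂ Ct {Y : 𝒴 | ‖Y‖ < R})
    (hquad : ∀ Y : 𝒴, ‖Y‖ < R → ‖Ct Y‖ ≤ C₂ * ‖Y‖ ^ 2) (hC₂ : 0 ≤ C₂)
    {Y : 𝒴} {ρ : ℝ} (hρ : 0 < ρ) (hYρ : ‖Y‖ + ρ < R) (Z : 𝒴) :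
    ‖fderiv ℂ Ct Y Z‖ ≤ C₂ * (‖Y‖ + ρ) ^ 2 / ρ * ‖Z‖ := by
  by_cases hZ : Z = 0
  · simp [hZ]
  have hZpos : 0 < ‖Z‖ := norm_pos_iff.mpr hZ
  have hOpen : IsOpen {Y : 𝒴 | ‖Y‖ < R} := isOpen_lt continuous_norm continuous_const
  set r : ℝ := ρ / ‖Z‖ with hr
  have hrpos : 0 < r := div_pos hρ hZpos
  have hrZ : r * ‖Z‖ = ρ := div_mul_cancel₀ ρ hZpos.ne'
  have hcont : Continuous fun τ : ℂ => Y + τ • Z := continuous_const.add (continuous_id.smul continuous_const)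
  have hgd : DifferentiableOn ℂ (fun τ : ℂ => Ct (Y + τ • Z)) {τ : ℂ | ‖Y + τ • Z‖ < R} := by
    intro τ hτ
    have h1 : DifferentiableAt ℂ (fun τ : ℂ => Y + τ • Z) τ :=
      (differentiableAt_id.smul_const Z).const_add Y
    have h2 : DifferentiableAt ℂ Ct (Y + τ • Z) := hCd.differentiableAt (hOpen.mem_nhds hτ)
    exact (h2.comp τ h1).differentiableWithinAt
  have hsub : closedBall (0:ℂ) r ⊆ {τ : ℂ | ‖Y + τ • Z‖ < R} := by
    intro τ hτ
    rw [mem_closedBall_zero_iff] at hτ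
    show ‖Y + τ • Z‖ < R
    calc ‖Y + τ • Z‖ ≤ ‖Y‖ + ‖τ • Z‖ := norm_add_le _ _
      _ = ‖Y‖ + ‖τ‖ * ‖Z‖ := by rw [norm_smul]
      _ ≤ ‖Y‖ + r * ‖Z‖ := by gcongr
      _ = ‖Y‖ + ρ := by rw [hrZ]
      _ < R := hYρ
  have hM : ∀ τ ∈ sphere (0:ℂ) r, ‖Ct (Y + τ • Z)‖ ≤ C₂ * (‖Y‖ + ρ) ^ 2 := by
    intro τ hτ
    rw [mem_sphere_zero_iff_norm] at hτ
    have hn : ‖Y + τ • Z‖ ≤ ‖Y‖ + ρ := by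
      calc ‖Y + τ • Z‖ ≤ ‖Y‖ + ‖τ • Z‖ := norm_add_le _ _
        _ = ‖Y‖ + ρ := by rw [norm_smul, hτ, hrZ]
    calc ‖Ct (Y + τ • Z)‖ ≤ C₂ * ‖Y + τ • Z‖ ^ 2 := hquad _ (hn.trans_lt hYρ)
      _ ≤ C₂ * (‖Y‖ + ρ) ^ 2 := by gcongr
  have hderiv : ‖deriv (fun τ : ℂ => Ct (Y + τ • Z)) 0‖ ≤ C₂ * (‖Y‖ + ρ) ^ 2 / r :=
    Complex.norm_deriv_le_of_forall_mem_sphere_norm_le hrpos (hgd.diffContOnCl_ball hsub) hM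
  have hY : ‖Y‖ < R := by linarith [norm_nonneg Y]
  have hCY : HasFDerivAt Ct (fderiv ℂ Ct Y) (Y + (0:ℂ) • Z) := by
    rw [zero_smul, add_zero]; exact (hCd.differentiableAt (hOpen.mem_nhds hY)).hasFDerivAt
  have hline : HasDerivAt (fun τ : ℂ => Y + τ • Z) Z 0 := by
    simpa using ((hasDerivAt_id (0:ℂ)).smul_const Z).const_add Y
  have hcomp : HasDerivAt (fun τ : ℂ => Ct (Y + τ • Z)) (fderiv ℂ Ct Y Z) 0 :=
    hCY.comp_hasDerivAt (0:ℂ) hline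
  rw [hcomp.deriv] at hderiv
  calc ‖fderiv ℂ Ct Y Z‖ ≤ C₂ * (‖Y‖ + ρ) ^ 2 / r := hderiv
    _ = C₂ * (‖Y‖ + ρ) ^ 2 / ρ * ‖Z‖ := by rw [hr]; field_simp

/-- Operator-norm form of `norm_fderiv_apply_le_of_quad`: `‖DC̃(Y)‖ ≤ C₂(‖Y‖ + ρ)²/ρ`. [folklore] -/
theorem norm_fderiv_le_of_quad (hCd : DifferentiableOn ℂ Ct {Y : 𝒴 | ‖Y‖ < R})
    (hquad : ∀ Y : 𝒴, ‖Y‖ < R → ‖Ct Y‖ ≤ C₂ * ‖Y‖ ^ 2) (hC₂ : 0 ≤ C₂)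
    {Y : 𝒴} {ρ : ℝ} (hρ : 0 < ρ) (hYρ : ‖Y‖ + ρ < R) :
    ‖fderiv ℂ Ct Y‖ ≤ C₂ * (‖Y‖ + ρ) ^ 2 / ρ :=
  ContinuousLinearMap.opNorm_le_bound _ (by positivity)
    (fun Z => norm_fderiv_apply_le_of_quad hCd hquad hC₂ hρ hYρ Z)

/-- **`‖DC̃(Y)‖ ≤ 9C₂ε` on `‖Y‖ < 2ε`** (take `ρ = ε`, `3ε ≤ R`): the derivative bound behind the Lipschitz
constant of `C̃` on the doubled ball and behind the invertibility of `I + DC̃(Y₀)h`; times the bound `b` of `h`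
it is the contraction constant `9C₂bε` of `B13Contraction113` ([15] p. 286 «9C₂B₀ε₃», `B₀ ↔ b`, `ε₃ ↔ ε`).
[folklore] -/
theorem norm_fderiv_le_of_lt_two (hCd : DifferentiableOn ℂ Ct {Y : 𝒴 | ‖Y‖ < R})
    (hquad : ∀ Y : 𝒴, ‖Y‖ < R → ‖Ct Y‖ ≤ C₂ * ‖Y‖ ^ 2) (hC₂ : 0 ≤ C₂) {ε : ℝ} (hRC : 3 * ε ≤ R)
    {Y : 𝒴} (hY : ‖Y‖ < 2 * ε) : ‖fderiv ℂ Ct Y‖ ≤ 9 * C₂ * ε := by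
  have hε : 0 < ε := by linarith [norm_nonneg Y]
  have hYρ : ‖Y‖ + ε < R := by linarith
  have h := norm_fderiv_le_of_quad hCd hquad hC₂ hε hYρ
  have h2 : C₂ * (‖Y‖ + ε) ^ 2 / ε ≤ 9 * C₂ * ε := by
    rw [div_le_iff₀ hε]
    have : (‖Y‖ + ε) ^ 2 ≤ (3 * ε) ^ 2 := by
      gcongr; linarith
    nlinarith
  exact h.trans h2

/-- **`‖DC̃(Y)‖ ≤ 9C₂‖B‖` when `‖Y‖ ≤ 2‖B‖`, `0 < ‖B‖`, `3‖B‖ < R`** (take `ρ = ‖B‖`): the `O(‖B‖)` form used at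
`Y₀ = B − hD̃(B)`, which makes the Jacobian of the change of variables `O(‖B‖)`-close to the identity. [folklore] -/
theorem norm_fderiv_le_of_le_two_norm (hCd : DifferentiableOn ℂ Ct {Y : 𝒴 | ‖Y‖ < R})
    (hquad : ∀ Y : 𝒴, ‖Y‖ < R → ‖Ct Y‖ ≤ C₂ * ‖Y‖ ^ 2) (hC₂ : 0 ≤ C₂) {B Y : 𝒴} (hB : 0 < ‖B‖)
    (hBR : 3 * ‖B‖ < R) (hY : ‖Y‖ ≤ 2 * ‖B‖) : ‖fderiv ℂ Ct Y‖ ≤ 9 * C₂ * ‖B‖ := by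
  have hYρ : ‖Y‖ + ‖B‖ < R := by linarith
  have h := norm_fderiv_le_of_quad hCd hquad hC₂ hB hYρ
  have h2 : C₂ * (‖Y‖ + ‖B‖) ^ 2 / ‖B‖ ≤ 9 * C₂ * ‖B‖ := by
    rw [div_le_iff₀ hB]
    have : (‖Y‖ + ‖B‖) ^ 2 ≤ (3 * ‖B‖) ^ 2 := by
      gcongr; linarith
    nlinarith
  exact h.trans h2

/-- **Lipschitz bound for `C̃` on the doubled ball** `‖Y‖ < 2ε` (`3ε ≤ R`): `‖C̃(Y₁) − C̃(Y₂)‖ ≤ 9C₂ε‖Y₁ − Y₂‖`,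
by the mean value inequality on the convex ball with `norm_fderiv_le_of_lt_two` — the Fréchet form of
`B13Contraction113.lipschitz_T` (which bounds differences along the direction `h(X₁ − X₂)` only). [folklore] -/
theorem norm_sub_le_of_lt_two (hCd : DifferentiableOn ℂ Ct {Y : 𝒴 | ‖Y‖ < R})
    (hquad : ∀ Y : 𝒴, ‖Y‖ < R → ‖Ct Y‖ ≤ C₂ * ‖Y‖ ^ 2) (hC₂ : 0 ≤ C₂) {ε : ℝ} (hRC : 3 * ε ≤ R)
    {Y₁ Y₂ : 𝒴} (h₁ : ‖Y₁‖ < 2 * ε) (h₂ : ‖Y₂‖ < 2 * ε) :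
    ‖Ct Y₁ - Ct Y₂‖ ≤ 9 * C₂ * ε * ‖Y₁ - Y₂‖ := by
  have hOpen : IsOpen {Y : 𝒴 | ‖Y‖ < R} := isOpen_lt continuous_norm continuous_const
  have hdiff : ∀ Y ∈ ball (0:𝒴) (2 * ε), DifferentiableAt ℂ Ct Y := by
    intro Y hY
    rw [mem_ball_zero_iff] at hY
    exact hCd.differentiableAt (hOpen.mem_nhds (by show ‖Y‖ < R; linarith [norm_nonneg Y]))
  have hbd : ∀ Y ∈ ball (0:𝒴) (2 * ε), ‖fderiv ℂ Ct Y‖ ≤ 9 * C₂ * ε := fun Y hY =>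
    norm_fderiv_le_of_lt_two hCd hquad hC₂ hRC (mem_ball_zero_iff.mp hY)
  exact (convex_ball (0:𝒴) (2 * ε)).norm_image_sub_le_of_norm_fderiv_le hdiff hbd
    (mem_ball_zero_iff.mpr h₂) (mem_ball_zero_iff.mpr h₁)

end cauchy

/-! ## §2  Lipschitz continuity of `D̃` on `‖B‖ < ε` -/

section lipschitz

variable {𝒳 𝒴 : Type*} [NormedAddCommGroup 𝒳] [NormedSpace ℂ 𝒳] [CompleteSpace 𝒳]
  [NormedAddCommGroup 𝒴] [NormedSpace ℂ 𝒴]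
  {hop : 𝒳 →ₗ[ℂ] 𝒴} {Ct : 𝒴 → 𝒳} {C₂ R b ε : ℝ} {Dt : 𝒴 → 𝒳}

/-- **`D̃` is Lipschitz on `‖B‖ < ε`**: `‖D̃(B₁) − D̃(B₂)‖ ≤ 9C₂ε(1 − 9C₂bε)⁻¹‖B₁ − B₂‖`.  From the fixed-point
equation `D̃(Bᵢ) = C̃(Bᵢ − hD̃(Bᵢ))`, the Lipschitz bound for `C̃` on `‖Y‖ < 2ε` (where `Bᵢ − hD̃(Bᵢ)` lies by
`B12Lineariz267.mapsTo_phi`) and `‖hX‖ ≤ b‖X‖`, absorbing the term `9C₂ε·b‖D̃(B₁) − D̃(B₂)‖`. [folklore] -/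
theorem norm_Dt_sub_Dt_le (hC : QuadAnalytic Ct C₂ R) (hCd : DifferentiableOn ℂ Ct {Y : 𝒴 | ‖Y‖ < R})
    (hC₂ : 0 ≤ C₂) (hb : 0 ≤ b) (hHop : ∀ X, ‖hop X‖ ≤ b * ‖X‖) (hq : 9 * C₂ * b * ε < 1)
    (hRC : 3 * ε ≤ R) (hDball : ∀ B : 𝒴, ‖B‖ < ε → Dt B ∈ closedBall (0:𝒳) (4 * C₂ * ε ^ 2))
    (hDfix : ∀ B : 𝒴, ‖B‖ < ε → Ct (B - hop (Dt B)) = Dt B) {B₁ B₂ : 𝒴} (h₁ : ‖B₁‖ < ε)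
    (h₂ : ‖B₂‖ < ε) :
    ‖Dt B₁ - Dt B₂‖ ≤ 9 * C₂ * ε / (1 - 9 * C₂ * b * ε) * ‖B₁ - B₂‖ := by
  have hY₁ : ‖B₁ - hop (Dt B₁)‖ < 2 * ε := mem_ball_zero_iff.mp
    (mapsTo_phi hC hC₂ hb hHop hq hRC hDball hDfix (mem_ball_zero_iff.mpr h₁))
  have hY₂ : ‖B₂ - hop (Dt B₂)‖ < 2 * ε := mem_ball_zero_iff.mp
    (mapsTo_phi hC hC₂ hb hHop hq hRC hDball hDfix (mem_ball_zero_iff.mpr h₂))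
  have hkey : ‖Dt B₁ - Dt B₂‖ ≤ 9 * C₂ * ε * (‖B₁ - B₂‖ + b * ‖Dt B₁ - Dt B₂‖) := by
    have hε : 0 < ε := by linarith [norm_nonneg B₁]
    calc ‖Dt B₁ - Dt B₂‖ = ‖Ct (B₁ - hop (Dt B₁)) - Ct (B₂ - hop (Dt B₂))‖ := by
          rw [hDfix B₁ h₁, hDfix B₂ h₂]
      _ ≤ 9 * C₂ * ε * ‖(B₁ - hop (Dt B₁)) - (B₂ - hop (Dt B₂))‖ :=
          norm_sub_le_of_lt_two hCd hC.quad hC₂ hRC hY₁ hY₂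
      _ = 9 * C₂ * ε * ‖(B₁ - B₂) - hop (Dt B₁ - Dt B₂)‖ := by
          congr 2; rw [map_sub]; abel
      _ ≤ 9 * C₂ * ε * (‖B₁ - B₂‖ + ‖hop (Dt B₁ - Dt B₂)‖) :=
          mul_le_mul_of_nonneg_left (norm_sub_le _ _) (by positivity)
      _ ≤ 9 * C₂ * ε * (‖B₁ - B₂‖ + b * ‖Dt B₁ - Dt B₂‖) :=
          mul_le_mul_of_nonneg_left (by linarith [hHop (Dt B₁ - Dt B₂)]) (by positivity)
  have h1q : 0 < 1 - 9 * C₂ * b * ε := sub_pos.mpr hq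
  rw [div_mul_eq_mul_div, le_div_iff₀ h1q]
  nlinarith [hkey, norm_nonneg (Dt B₁ - Dt B₂), norm_nonneg (B₁ - B₂)]

/-- **`D̃` is continuous on `‖B‖ < ε`** (from the Lipschitz bound). [folklore] -/
theorem continuousOn_Dt (hC : QuadAnalytic Ct C₂ R) (hCd : DifferentiableOn ℂ Ct {Y : 𝒴 | ‖Y‖ < R})
    (hC₂ : 0 ≤ C₂) (hb : 0 ≤ b) (hHop : ∀ X, ‖hop X‖ ≤ b * ‖X‖) (hq : 9 * C₂ * b * ε < 1)
    (hRC : 3 * ε ≤ R) (hDball : ∀ B : 𝒴, ‖B‖ < ε → Dt B ∈ closedBall (0:𝒳) (4 * C₂ * ε ^ 2))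
    (hDfix : ∀ B : 𝒴, ‖B‖ < ε → Ct (B - hop (Dt B)) = Dt B) :
    ContinuousOn Dt (ball (0:𝒴) ε) := by
  set K : ℝ := 9 * C₂ * ε / (1 - 9 * C₂ * b * ε) with hK
  rw [Metric.continuousOn_iff]
  intro B₀ hB₀ η hη
  have hε : 0 < ε := by have := mem_ball_zero_iff.mp hB₀; linarith [norm_nonneg B₀]
  have hK0 : 0 ≤ K := div_nonneg (by positivity) (sub_pos.mpr hq).le
  refine ⟨η / (K + 1), by positivity, fun B hB hd => ?_⟩
  rw [dist_eq_norm] at hd ⊢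
  have hle := norm_Dt_sub_Dt_le hC hCd hC₂ hb hHop hq hRC hDball hDfix (mem_ball_zero_iff.mp hB)
    (mem_ball_zero_iff.mp hB₀)
  calc ‖Dt B - Dt B₀‖ ≤ K * ‖B - B₀‖ := hle
    _ ≤ K * (η / (K + 1)) := by gcongr
    _ < (K + 1) * (η / (K + 1)) := by gcongr; linarith
    _ = η := by field_simp

end lipschitz

/-! ## §3  The Neumann series in `𝒳 →L[ℂ] 𝒳`: `I + A` is invertible for `‖A‖ ≤ q < 1` -/

section neumann

variable {E : Type*} [NormedAddCommGroup E] [NormedSpace ℂ E] [CompleteSpace E]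

/-- **Neumann series**: on a complex Banach space, `‖A‖ ≤ q < 1` makes `I + A` invertible (as a continuous
linear map, Mathlib `ContinuousLinearMap.IsInvertible`) with `‖(I + A)⁻¹‖ ≤ (1 − q)⁻¹` — via Mathlib's
`Units.oneSub` / `tsum_geometric_le_of_norm_lt_one` in the Banach algebra `E →L[ℂ] E`.  (The tree's
`BlockAveragingFederbushAnalytic.isInvertible_of_norm_sub_one_le` is the same fact for a normed *algebra* acting on
itself; here the map acts on a general Banach space.) [folklore] -/
theorem isInvertible_id_add_of_norm_le {A : E →L[ℂ] E} {q : ℝ} (hA : ‖A‖ ≤ q) (hq : q < 1) :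
    (ContinuousLinearMap.id ℂ E + A).IsInvertible ∧
      ‖(ContinuousLinearMap.id ℂ E + A).inverse‖ ≤ (1 - q)⁻¹ := by
  have hA1 : ‖-A‖ < 1 := by rw [norm_neg]; exact hA.trans_lt hq
  set U := Units.oneSub (-A) hA1 with hU
  have hUval : (U : E →L[ℂ] E) = ContinuousLinearMap.id ℂ E + A := by
    rw [hU, Units.val_oneSub, sub_neg_eq_add, ContinuousLinearMap.one_def]
  have hf : (ContinuousLinearMap.id ℂ E + A) ∘L (↑U⁻¹ : E →L[ℂ] E) = ContinuousLinearMap.id ℂ E := by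
    rw [← hUval, ← ContinuousLinearMap.mul_def, Units.mul_inv, ContinuousLinearMap.one_def]
  have hg : (↑U⁻¹ : E →L[ℂ] E) ∘L (ContinuousLinearMap.id ℂ E + A) = ContinuousLinearMap.id ℂ E := by
    rw [← hUval, ← ContinuousLinearMap.mul_def, Units.inv_mul, ContinuousLinearMap.one_def]
  refine ⟨ContinuousLinearMap.IsInvertible.of_inverse hf hg, ?_⟩
  rw [ContinuousLinearMap.inverse_eq hf hg]
  have hinv : (↑U⁻¹ : E →L[ℂ] E) = ∑' n : ℕ, (-A) ^ n := by rw [hU]; rfl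
  rw [hinv]
  have h1 : ‖(1 : E →L[ℂ] E)‖ ≤ 1 := by
    rw [ContinuousLinearMap.one_def]; exact ContinuousLinearMap.norm_id_le
  have h2 : (1 - ‖-A‖)⁻¹ ≤ (1 - q)⁻¹ := by
    rw [norm_neg]
    exact inv_anti₀ (sub_pos.mpr hq) (by linarith)
  calc ‖∑' n : ℕ, (-A) ^ n‖ ≤ ‖(1 : E →L[ℂ] E)‖ - 1 + (1 - ‖-A‖)⁻¹ := tsum_geometric_le_of_norm_lt_one _ hA1
    _ ≤ (1 - q)⁻¹ := by linarith

end neumann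

/-! ## §4  The complex-analytic implicit function theorem at `(B₀, D̃(B₀))` -/

section implicit

variable {𝒳 𝒴 : Type*} [NormedAddCommGroup 𝒳] [NormedSpace ℂ 𝒳] [CompleteSpace 𝒳]
  [NormedAddCommGroup 𝒴] [NormedSpace ℂ 𝒴]
  {hop : 𝒳 →ₗ[ℂ] 𝒴} {Ct : 𝒴 → 𝒳} {C₂ R b ε : ℝ} {Dt : 𝒴 → 𝒳}

omit [CompleteSpace 𝒳] in
/-- Partial derivative of `(B, X) ↦ X − D(B − hX)` in `X`: `I + Dh` (pure algebra; `D` stands for `DC̃(Y₀)`,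
`hL` for `h` as a continuous linear map). [folklore] -/
theorem partial_snd (D : 𝒴 →L[ℂ] 𝒳) (hL : 𝒳 →L[ℂ] 𝒴) :
    (ContinuousLinearMap.snd ℂ 𝒴 𝒳 -
        D ∘L (ContinuousLinearMap.fst ℂ 𝒴 𝒳 - hL ∘L ContinuousLinearMap.snd ℂ 𝒴 𝒳)) ∘L
      ContinuousLinearMap.inr ℂ 𝒴 𝒳 = ContinuousLinearMap.id ℂ 𝒳 + D ∘L hL := by
  ext X; simp

omit [CompleteSpace 𝒳] in
/-- Partial derivative of `(B, X) ↦ X − D(B − hX)` in `B`: `−D`. [folklore] -/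
theorem partial_fst (D : 𝒴 →L[ℂ] 𝒳) (hL : 𝒳 →L[ℂ] 𝒴) :
    (ContinuousLinearMap.snd ℂ 𝒴 𝒳 -
        D ∘L (ContinuousLinearMap.fst ℂ 𝒴 𝒳 - hL ∘L ContinuousLinearMap.snd ℂ 𝒴 𝒳)) ∘L
      ContinuousLinearMap.inl ℂ 𝒴 𝒳 = -D := by
  ext B; simp

omit [CompleteSpace 𝒳] in
/-- The implicit equation `F(B, X) = X − C̃(B − hX)` is Fréchet-differentiable at every `(B, X)` with
`‖B − hX‖ < R`, with derivative `pr₂ − DC̃(B − hX)∘(pr₁ − h∘pr₂)` (chain rule). [folklore] -/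
theorem hasFDerivAt_fixEq (hCd : DifferentiableOn ℂ Ct {Y : 𝒴 | ‖Y‖ < R})
    (hHop : ∀ X, ‖hop X‖ ≤ b * ‖X‖) (B : 𝒴) (X : 𝒳) (hp : ‖B - hop X‖ < R) :
    HasFDerivAt (fun p : 𝒴 × 𝒳 => p.2 - Ct (p.1 - hop p.2))
      (ContinuousLinearMap.snd ℂ 𝒴 𝒳 - (fderiv ℂ Ct (B - hop X)) ∘L
        (ContinuousLinearMap.fst ℂ 𝒴 𝒳 - (hop.mkContinuous b hHop) ∘L ContinuousLinearMap.snd ℂ 𝒴 𝒳))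
      (B, X) := by
  have hOpen : IsOpen {Y : 𝒴 | ‖Y‖ < R} := isOpen_lt continuous_norm continuous_const
  set lin := ContinuousLinearMap.fst ℂ 𝒴 𝒳 - (hop.mkContinuous b hHop) ∘L ContinuousLinearMap.snd ℂ 𝒴 𝒳
    with hlin
  have hlin_apply : ∀ x : 𝒴 × 𝒳, lin x = x.1 - hop x.2 := fun x => by simp [hlin]
  have hC : HasFDerivAt Ct (fderiv ℂ Ct (B - hop X)) (lin (B, X)) := by
    rw [hlin_apply]; exact (hCd.differentiableAt (hOpen.mem_nhds hp)).hasFDerivAt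
  have hF := (ContinuousLinearMap.snd ℂ 𝒴 𝒳).hasFDerivAt.sub (hC.comp (B, X) lin.hasFDerivAt)
  have hfun : (fun p : 𝒴 × 𝒳 => p.2 - Ct (p.1 - hop p.2)) =
      fun p => (ContinuousLinearMap.snd ℂ 𝒴 𝒳) p - (Ct ∘ ⇑lin) p := by
    funext p; simp [hlin_apply]
  rw [hfun]; exact hF

omit [CompleteSpace 𝒳] in
/-- … and ANALYTIC there when `C̃` is analytic on `‖Y‖ < R` (composition with a continuous linear map).
[folklore] -/
theorem analyticAt_fixEq (hCa : AnalyticOnNhd ℂ Ct {Y : 𝒴 | ‖Y‖ < R})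
    (hHop : ∀ X, ‖hop X‖ ≤ b * ‖X‖) (B : 𝒴) (X : 𝒳) (hp : ‖B - hop X‖ < R) :
    AnalyticAt ℂ (fun p : 𝒴 × 𝒳 => p.2 - Ct (p.1 - hop p.2)) (B, X) := by
  set lin := ContinuousLinearMap.fst ℂ 𝒴 𝒳 - (hop.mkContinuous b hHop) ∘L ContinuousLinearMap.snd ℂ 𝒴 𝒳
    with hlin
  have hlin_apply : ∀ x : 𝒴 × 𝒳, lin x = x.1 - hop x.2 := fun x => by simp [hlin]
  have hC : AnalyticAt ℂ Ct (lin (B, X)) := by rw [hlin_apply]; exact hCa _ hp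
  have hF := ((ContinuousLinearMap.snd ℂ 𝒴 𝒳).analyticAt (B, X)).sub (hC.comp (lin.analyticAt (B, X)))
  have hfun : (fun p : 𝒴 × 𝒳 => p.2 - Ct (p.1 - hop p.2)) =
      fun p => (ContinuousLinearMap.snd ℂ 𝒴 𝒳) p - (Ct ∘ ⇑lin) p := by
    funext p; simp [hlin_apply]
  rw [hfun]; exact hF

/-- **The partial derivative in the unknown is invertible**: at `Y₀ = B₀ − hD̃(B₀)` (`‖B₀‖ < ε`, so `‖Y₀‖ < 2ε` by
`B12Lineariz267.mapsTo_phi`), `‖DC̃(Y₀)h‖ ≤ 9C₂ε·b < 1`, hence `I + DC̃(Y₀)h` is invertible with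
`‖(I + DC̃(Y₀)h)⁻¹‖ ≤ (1 − 9C₂bε)⁻¹` (Neumann series, §3). [folklore] -/
theorem isInvertible_id_add_fderiv_comp_hop (hC : QuadAnalytic Ct C₂ R)
    (hCd : DifferentiableOn ℂ Ct {Y : 𝒴 | ‖Y‖ < R}) (hC₂ : 0 ≤ C₂) (hb : 0 ≤ b)
    (hHop : ∀ X, ‖hop X‖ ≤ b * ‖X‖) (hq : 9 * C₂ * b * ε < 1) (hRC : 3 * ε ≤ R)
    (hDball : ∀ B : 𝒴, ‖B‖ < ε → Dt B ∈ closedBall (0:𝒳) (4 * C₂ * ε ^ 2))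
    (hDfix : ∀ B : 𝒴, ‖B‖ < ε → Ct (B - hop (Dt B)) = Dt B) {B₀ : 𝒴} (hB₀ : ‖B₀‖ < ε) :
    (ContinuousLinearMap.id ℂ 𝒳 + fderiv ℂ Ct (B₀ - hop (Dt B₀)) ∘L hop.mkContinuous b hHop).IsInvertible ∧
      ‖(ContinuousLinearMap.id ℂ 𝒳 + fderiv ℂ Ct (B₀ - hop (Dt B₀)) ∘L hop.mkContinuous b hHop).inverse‖ ≤
        (1 - 9 * C₂ * b * ε)⁻¹ := by
  have hY₀ : ‖B₀ - hop (Dt B₀)‖ < 2 * ε :=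
    mem_ball_zero_iff.mp (mapsTo_phi hC hC₂ hb hHop hq hRC hDball hDfix (mem_ball_zero_iff.mpr hB₀))
  have hD₀ : ‖fderiv ℂ Ct (B₀ - hop (Dt B₀))‖ ≤ 9 * C₂ * ε := norm_fderiv_le_of_lt_two hCd hC.quad hC₂ hRC hY₀
  have hε : 0 ≤ ε := by linarith [norm_nonneg B₀]
  have hDh : ‖fderiv ℂ Ct (B₀ - hop (Dt B₀)) ∘L hop.mkContinuous b hHop‖ ≤ 9 * C₂ * b * ε := by
    calc ‖fderiv ℂ Ct (B₀ - hop (Dt B₀)) ∘L hop.mkContinuous b hHop‖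
          ≤ ‖fderiv ℂ Ct (B₀ - hop (Dt B₀))‖ * ‖hop.mkContinuous b hHop‖ := ContinuousLinearMap.opNorm_comp_le _ _
      _ ≤ (9 * C₂ * ε) * b :=
          mul_le_mul hD₀ (LinearMap.mkContinuous_norm_le _ hb _) (norm_nonneg _) (by positivity)
      _ = 9 * C₂ * b * ε := by ring
  exact isInvertible_id_add_of_norm_le hDh hq

/-- **`‖DC̃(Y₀)‖ ≤ 9C₂‖B₀‖` at `Y₀ = B₀ − hD̃(B₀)`** (`‖B₀‖ < ε`): since `‖hD̃(B₀)‖ ≤ 4C₂b‖B₀‖² ≤ ‖B₀‖`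
(`B12Lineariz267.norm_hop_Dt_le`, `4C₂bε ≤ 1`), `‖Y₀‖ ≤ 2‖B₀‖` and `norm_fderiv_le_of_le_two_norm` applies; at
`B₀ = 0`, `Y₀ = 0` and `DC̃(0) = 0` (Cauchy with `ρ ↓ 0`). [folklore] -/
theorem norm_fderiv_Ct_phi_le (hC : QuadAnalytic Ct C₂ R) (hCd : DifferentiableOn ℂ Ct {Y : 𝒴 | ‖Y‖ < R})
    (hC₂ : 0 ≤ C₂) (hb : 0 ≤ b) (hHop : ∀ X, ‖hop X‖ ≤ b * ‖X‖) (hq : 9 * C₂ * b * ε < 1)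
    (hRC : 3 * ε ≤ R) (hDball : ∀ B : 𝒴, ‖B‖ < ε → Dt B ∈ closedBall (0:𝒳) (4 * C₂ * ε ^ 2))
    (hDfix : ∀ B : 𝒴, ‖B‖ < ε → Ct (B - hop (Dt B)) = Dt B) {B₀ : 𝒴} (hB₀ : ‖B₀‖ < ε) :
    ‖fderiv ℂ Ct (B₀ - hop (Dt B₀))‖ ≤ 9 * C₂ * ‖B₀‖ := by
  have hε : 0 < ε := by linarith [norm_nonneg B₀]
  by_cases h0 : B₀ = 0
  · -- at `B₀ = 0`: `D̃(0) = 0`, `Y₀ = 0`, and `‖DC̃(0)‖ ≤ C₂ρ` for every `0 < ρ < R` (Cauchy), so `DC̃(0) = 0`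
    subst h0
    have hD0 : Dt (0:𝒴) = 0 := by
      have h := norm_Dt_le hC hC₂ hb hHop hq hRC hDball hDfix (B := (0:𝒴)) (by simpa using hε)
      simpa using h
    rw [hD0, map_zero, sub_zero, norm_zero, mul_zero]
    refine le_of_forall_pos_le_add fun η hη => ?_
    have hρ : 0 < min ε (η / (C₂ + 1)) := lt_min hε (by positivity)
    have hρR : ‖(0:𝒴)‖ + min ε (η / (C₂ + 1)) < R :=
      by rw [norm_zero, zero_add]; exact (min_le_left _ _).trans_lt (by linarith)
    calc ‖fderiv ℂ Ct (0:𝒴)‖ ≤ C₂ * (‖(0:𝒴)‖ + min ε (η / (C₂ + 1))) ^ 2 / min ε (η / (C₂ + 1)) :=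
          norm_fderiv_le_of_quad hCd hC.quad hC₂ hρ hρR
      _ = C₂ * min ε (η / (C₂ + 1)) := by rw [norm_zero, zero_add, sq, ← mul_assoc, mul_div_cancel_right₀ _ hρ.ne']
      _ ≤ C₂ * (η / (C₂ + 1)) := by gcongr; exact min_le_right _ _
      _ ≤ (C₂ + 1) * (η / (C₂ + 1)) := by gcongr; linarith
      _ = 0 + η := by field_simp; ring
  · have hBpos : 0 < ‖B₀‖ := norm_pos_iff.mpr h0
    have h1 := (norm_hop_Dt_le hC hC₂ hb hHop hq hRC hDball hDfix hB₀).1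
    have h9 : 0 ≤ 9 * C₂ * b := by positivity
    have h4 : 4 * C₂ * b * ‖B₀‖ ≤ 1 := by nlinarith [mul_nonneg h9 hBpos.le]
    have hY : ‖B₀ - hop (Dt B₀)‖ ≤ 2 * ‖B₀‖ := by
      calc ‖B₀ - hop (Dt B₀)‖ ≤ ‖B₀‖ + ‖hop (Dt B₀)‖ := norm_sub_le _ _
        _ ≤ ‖B₀‖ + 4 * C₂ * b * ‖B₀‖ ^ 2 := by gcongr
        _ = ‖B₀‖ + (4 * C₂ * b * ‖B₀‖) * ‖B₀‖ := by ring
        _ ≤ ‖B₀‖ + 1 * ‖B₀‖ := by gcongr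
        _ = 2 * ‖B₀‖ := by ring
    exact norm_fderiv_le_of_le_two_norm hCd hC.quad hC₂ hBpos (by linarith) hY

variable [CompleteSpace 𝒴]

/-- **JOINT ANALYTICITY OF `D̃` AND ITS DERIVATIVE** (print: «it is an analytic function of B»).  Under the
hypotheses of `B12Lineariz267` plus: `C̃` ANALYTIC (`AnalyticOnNhd ℂ`) on `‖Y‖ < R` and `𝒴` complete, the chosen
fixed point `D̃` is complex-analytic (Fréchet) at every `‖B₀‖ < ε`, with strict derivative
`DD̃(B₀) = (I + DC̃(Y₀)h)⁻¹ DC̃(Y₀)`, `Y₀ = B₀ − hD̃(B₀)`.  Proof: Mathlib's analytic implicit function theorem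
(`ContDiffAt.implicitFunction` at `n = ω` over `ℂ`) for `F(B, X) = X − C̃(B − hX)` at `(B₀, D̃(B₀))`
(`analyticAt_fixEq`, `partial_snd` + `isInvertible_id_add_fderiv_comp_hop`), and the identification of the implicit
function with `D̃` near `B₀` (`eventually_apply_eq_iff_implicitFunction` + continuity of `B ↦ (B, D̃(B))`,
`continuousOn_Dt`, + `F(B, D̃(B)) = 0`) — the pattern of the tree's `BlockAveragingFederbushAnalytic` §A1. [folklore] -/
theorem analyticAt_and_hasStrictFDerivAt_Dt (hC : QuadAnalytic Ct C₂ R)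
    (hCa : AnalyticOnNhd ℂ Ct {Y : 𝒴 | ‖Y‖ < R}) (hC₂ : 0 ≤ C₂) (hb : 0 ≤ b)
    (hHop : ∀ X, ‖hop X‖ ≤ b * ‖X‖) (hq : 9 * C₂ * b * ε < 1) (hRC : 3 * ε ≤ R)
    (hDball : ∀ B : 𝒴, ‖B‖ < ε → Dt B ∈ closedBall (0:𝒳) (4 * C₂ * ε ^ 2))
    (hDfix : ∀ B : 𝒴, ‖B‖ < ε → Ct (B - hop (Dt B)) = Dt B) {B₀ : 𝒴} (hB₀ : ‖B₀‖ < ε) :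
    AnalyticAt ℂ Dt B₀ ∧
      HasStrictFDerivAt Dt
        ((ContinuousLinearMap.id ℂ 𝒳 + fderiv ℂ Ct (B₀ - hop (Dt B₀)) ∘L hop.mkContinuous b hHop).inverse ∘L
          fderiv ℂ Ct (B₀ - hop (Dt B₀))) B₀ := by
  have hCd : DifferentiableOn ℂ Ct {Y : 𝒴 | ‖Y‖ < R} := hCa.differentiableOn
  have hε : 0 < ε := by linarith [norm_nonneg B₀]
  have hω : (ω : ℕ∞ω) ≠ 0 := by simp
  have hY₀ : ‖B₀ - hop (Dt B₀)‖ < 2 * ε :=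
    mem_ball_zero_iff.mp (mapsTo_phi hC hC₂ hb hHop hq hRC hDball hDfix (mem_ball_zero_iff.mpr hB₀))
  have hY₀R : ‖B₀ - hop (Dt B₀)‖ < R := by linarith
  set F : 𝒴 × 𝒳 → 𝒳 := fun p => p.2 - Ct (p.1 - hop p.2) with hF
  have hFω : ContDiffAt ℂ ω F (B₀, Dt B₀) := (analyticAt_fixEq hCa hHop B₀ (Dt B₀) hY₀R).contDiffAt
  have hFd : fderiv ℂ F (B₀, Dt B₀) = ContinuousLinearMap.snd ℂ 𝒴 𝒳 - (fderiv ℂ Ct (B₀ - hop (Dt B₀))) ∘L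
      (ContinuousLinearMap.fst ℂ 𝒴 𝒳 - (hop.mkContinuous b hHop) ∘L ContinuousLinearMap.snd ℂ 𝒴 𝒳) :=
    (hasFDerivAt_fixEq hCd hHop B₀ (Dt B₀) hY₀R).fderiv
  have hJ := isInvertible_id_add_fderiv_comp_hop hC hCd hC₂ hb hHop hq hRC hDball hDfix hB₀
  have hinr : (fderiv ℂ F (B₀, Dt B₀) ∘L ContinuousLinearMap.inr ℂ 𝒴 𝒳).IsInvertible := by
    rw [hFd, partial_snd]; exact hJ.1
  -- identification of Mathlib's implicit function with `D̃` near `B₀`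
  have hcont : ContinuousAt Dt B₀ :=
    (continuousOn_Dt hC hCd hC₂ hb hHop hq hRC hDball hDfix).continuousAt
      (isOpen_ball.mem_nhds (mem_ball_zero_iff.mpr hB₀))
  have heq : hFω.implicitFunction hω hinr =ᶠ[𝓝 B₀] Dt := by
    have hψ := hFω.eventually_apply_eq_iff_implicitFunction hω hinr
    have ht : ContinuousAt (fun B : 𝒴 => (B, Dt B)) B₀ := continuousAt_id.prodMk hcont
    have h1 : ∀ᶠ B in 𝓝 B₀, F (B, Dt B) = F (B₀, Dt B₀) ↔
        hFω.implicitFunction hω hinr (B, Dt B).1 = (B, Dt B).2 := Filter.Tendsto.eventually ht hψ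
    have hball : ∀ᶠ B in 𝓝 B₀, ‖B‖ < ε := (isOpen_lt continuous_norm continuous_const).mem_nhds hB₀
    filter_upwards [h1, hball] with B h hBε
    refine h.1 ?_
    show Dt B - Ct (B - hop (Dt B)) = Dt B₀ - Ct (B₀ - hop (Dt B₀))
    rw [hDfix B hBε, hDfix B₀ hB₀, sub_self, sub_self]
  refine ⟨((hFω.contDiffAt_implicitFunction hω hinr).analyticAt).congr heq, ?_⟩
  have hψd := (hFω.hasStrictFDerivAt_implicitFunction hω hinr).congr_of_eventuallyEq heq
  refine hψd.congr_fderiv ?_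
  rw [hFd, partial_snd, partial_fst]
  ext B
  simp

/-- `D̃` is complex-analytic at every `‖B₀‖ < ε`. [folklore] -/
theorem analyticAt_Dt (hC : QuadAnalytic Ct C₂ R) (hCa : AnalyticOnNhd ℂ Ct {Y : 𝒴 | ‖Y‖ < R})
    (hC₂ : 0 ≤ C₂) (hb : 0 ≤ b) (hHop : ∀ X, ‖hop X‖ ≤ b * ‖X‖) (hq : 9 * C₂ * b * ε < 1)
    (hRC : 3 * ε ≤ R) (hDball : ∀ B : 𝒴, ‖B‖ < ε → Dt B ∈ closedBall (0:𝒳) (4 * C₂ * ε ^ 2))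
    (hDfix : ∀ B : 𝒴, ‖B‖ < ε → Ct (B - hop (Dt B)) = Dt B) {B₀ : 𝒴} (hB₀ : ‖B₀‖ < ε) :
    AnalyticAt ℂ Dt B₀ :=
  (analyticAt_and_hasStrictFDerivAt_Dt hC hCa hC₂ hb hHop hq hRC hDball hDfix hB₀).1

/-- **`D̃` is analytic on a neighbourhood of every point of the ball `‖B‖ < ε`** — the Fréchet (joint) form of
print's «it is an analytic function of B» for the chosen solution. [folklore] -/
theorem analyticOnNhd_Dt (hC : QuadAnalytic Ct C₂ R) (hCa : AnalyticOnNhd ℂ Ct {Y : 𝒴 | ‖Y‖ < R})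
    (hC₂ : 0 ≤ C₂) (hb : 0 ≤ b) (hHop : ∀ X, ‖hop X‖ ≤ b * ‖X‖) (hq : 9 * C₂ * b * ε < 1)
    (hRC : 3 * ε ≤ R) (hDball : ∀ B : 𝒴, ‖B‖ < ε → Dt B ∈ closedBall (0:𝒳) (4 * C₂ * ε ^ 2))
    (hDfix : ∀ B : 𝒴, ‖B‖ < ε → Ct (B - hop (Dt B)) = Dt B) :
    AnalyticOnNhd ℂ Dt (ball (0:𝒴) ε) := fun _ hB =>
  analyticAt_Dt hC hCa hC₂ hb hHop hq hRC hDball hDfix (mem_ball_zero_iff.mp hB)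

/-- Hence `D̃` is complex-(Fréchet-)differentiable on `‖B‖ < ε` (upgrading `B12Lineariz267.differentiableOn_Dt_line`,
which gave holomorphy along complex lines only). [folklore] -/
theorem differentiableOn_Dt (hC : QuadAnalytic Ct C₂ R) (hCa : AnalyticOnNhd ℂ Ct {Y : 𝒴 | ‖Y‖ < R})
    (hC₂ : 0 ≤ C₂) (hb : 0 ≤ b) (hHop : ∀ X, ‖hop X‖ ≤ b * ‖X‖) (hq : 9 * C₂ * b * ε < 1)
    (hRC : 3 * ε ≤ R) (hDball : ∀ B : 𝒴, ‖B‖ < ε → Dt B ∈ closedBall (0:𝒳) (4 * C₂ * ε ^ 2))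
    (hDfix : ∀ B : 𝒴, ‖B‖ < ε → Ct (B - hop (Dt B)) = Dt B) :
    DifferentiableOn ℂ Dt (ball (0:𝒴) ε) :=
  (analyticOnNhd_Dt hC hCa hC₂ hb hHop hq hRC hDball hDfix).differentiableOn

/-- **The derivative of `D̃`**: `DD̃(B₀) = (I + DC̃(Y₀)h)⁻¹ ∘ DC̃(Y₀)`, `Y₀ = B₀ − hD̃(B₀)` (implicit
differentiation of `D̃(B) = C̃(B − hD̃(B))`). [folklore] -/
theorem hasStrictFDerivAt_Dt (hC : QuadAnalytic Ct C₂ R) (hCa : AnalyticOnNhd ℂ Ct {Y : 𝒴 | ‖Y‖ < R})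
    (hC₂ : 0 ≤ C₂) (hb : 0 ≤ b) (hHop : ∀ X, ‖hop X‖ ≤ b * ‖X‖) (hq : 9 * C₂ * b * ε < 1)
    (hRC : 3 * ε ≤ R) (hDball : ∀ B : 𝒴, ‖B‖ < ε → Dt B ∈ closedBall (0:𝒳) (4 * C₂ * ε ^ 2))
    (hDfix : ∀ B : 𝒴, ‖B‖ < ε → Ct (B - hop (Dt B)) = Dt B) {B₀ : 𝒴} (hB₀ : ‖B₀‖ < ε) :
    HasStrictFDerivAt Dt
      ((ContinuousLinearMap.id ℂ 𝒳 + fderiv ℂ Ct (B₀ - hop (Dt B₀)) ∘L hop.mkContinuous b hHop).inverse ∘L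
        fderiv ℂ Ct (B₀ - hop (Dt B₀))) B₀ :=
  (analyticAt_and_hasStrictFDerivAt_Dt hC hCa hC₂ hb hHop hq hRC hDball hDfix hB₀).2

/-- `fderiv` form of `hasStrictFDerivAt_Dt`. [folklore] -/
theorem fderiv_Dt (hC : QuadAnalytic Ct C₂ R) (hCa : AnalyticOnNhd ℂ Ct {Y : 𝒴 | ‖Y‖ < R})
    (hC₂ : 0 ≤ C₂) (hb : 0 ≤ b) (hHop : ∀ X, ‖hop X‖ ≤ b * ‖X‖) (hq : 9 * C₂ * b * ε < 1)
    (hRC : 3 * ε ≤ R) (hDball : ∀ B : 𝒴, ‖B‖ < ε → Dt B ∈ closedBall (0:𝒳) (4 * C₂ * ε ^ 2))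
    (hDfix : ∀ B : 𝒴, ‖B‖ < ε → Ct (B - hop (Dt B)) = Dt B) {B₀ : 𝒴} (hB₀ : ‖B₀‖ < ε) :
    fderiv ℂ Dt B₀ =
      (ContinuousLinearMap.id ℂ 𝒳 + fderiv ℂ Ct (B₀ - hop (Dt B₀)) ∘L hop.mkContinuous b hHop).inverse ∘L
        fderiv ℂ Ct (B₀ - hop (Dt B₀)) :=
  (hasStrictFDerivAt_Dt hC hCa hC₂ hb hHop hq hRC hDball hDfix hB₀).hasFDerivAt.fderiv

/-- **`‖DD̃(B₀)‖ ≤ 9C₂‖B₀‖(1 − 9C₂bε)⁻¹`**: the derivative of `D̃` is `O(‖B₀‖)` (consistent with «D̃(B) has an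
expansion beginning with quadratic terms»). [folklore] -/
theorem norm_fderiv_Dt_le (hC : QuadAnalytic Ct C₂ R) (hCa : AnalyticOnNhd ℂ Ct {Y : 𝒴 | ‖Y‖ < R})
    (hC₂ : 0 ≤ C₂) (hb : 0 ≤ b) (hHop : ∀ X, ‖hop X‖ ≤ b * ‖X‖) (hq : 9 * C₂ * b * ε < 1)
    (hRC : 3 * ε ≤ R) (hDball : ∀ B : 𝒴, ‖B‖ < ε → Dt B ∈ closedBall (0:𝒳) (4 * C₂ * ε ^ 2))
    (hDfix : ∀ B : 𝒴, ‖B‖ < ε → Ct (B - hop (Dt B)) = Dt B) {B₀ : 𝒴} (hB₀ : ‖B₀‖ < ε) :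
    ‖fderiv ℂ Dt B₀‖ ≤ 9 * C₂ * ‖B₀‖ * (1 - 9 * C₂ * b * ε)⁻¹ := by
  have hCd : DifferentiableOn ℂ Ct {Y : 𝒴 | ‖Y‖ < R} := hCa.differentiableOn
  have hJ := isInvertible_id_add_fderiv_comp_hop hC hCd hC₂ hb hHop hq hRC hDball hDfix hB₀
  have hD := norm_fderiv_Ct_phi_le hC hCd hC₂ hb hHop hq hRC hDball hDfix hB₀
  rw [fderiv_Dt hC hCa hC₂ hb hHop hq hRC hDball hDfix hB₀]
  calc _ ≤ ‖(ContinuousLinearMap.id ℂ 𝒳 + fderiv ℂ Ct (B₀ - hop (Dt B₀)) ∘L hop.mkContinuous b hHop).inverse‖ *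
        ‖fderiv ℂ Ct (B₀ - hop (Dt B₀))‖ := ContinuousLinearMap.opNorm_comp_le _ _
    _ ≤ (1 - 9 * C₂ * b * ε)⁻¹ * (9 * C₂ * ‖B₀‖) :=
        mul_le_mul hJ.2 hD (norm_nonneg _) (inv_nonneg.mpr (sub_pos.mpr hq).le)
    _ = 9 * C₂ * ‖B₀‖ * (1 - 9 * C₂ * b * ε)⁻¹ := by ring

/-- **The change of variables `Φ(B) = B − hD̃(B)` is analytic with `DΦ(B₀) = I − h∘DD̃(B₀)`** — the operator
under the `Tr log` of (2.12) p. 268 («Tr log(I − h((δ/δB)D̃)(g_kCB))», i.e. the Jacobian of the substitution).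
[folklore] -/
theorem hasStrictFDerivAt_phi (hC : QuadAnalytic Ct C₂ R) (hCa : AnalyticOnNhd ℂ Ct {Y : 𝒴 | ‖Y‖ < R})
    (hC₂ : 0 ≤ C₂) (hb : 0 ≤ b) (hHop : ∀ X, ‖hop X‖ ≤ b * ‖X‖) (hq : 9 * C₂ * b * ε < 1)
    (hRC : 3 * ε ≤ R) (hDball : ∀ B : 𝒴, ‖B‖ < ε → Dt B ∈ closedBall (0:𝒳) (4 * C₂ * ε ^ 2))
    (hDfix : ∀ B : 𝒴, ‖B‖ < ε → Ct (B - hop (Dt B)) = Dt B) {B₀ : 𝒴} (hB₀ : ‖B₀‖ < ε) :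
    HasStrictFDerivAt (fun B => B - hop (Dt B))
      (ContinuousLinearMap.id ℂ 𝒴 - hop.mkContinuous b hHop ∘L fderiv ℂ Dt B₀) B₀ := by
  have hD := (hasStrictFDerivAt_Dt hC hCa hC₂ hb hHop hq hRC hDball hDfix hB₀).hasFDerivAt
  have hD' : HasStrictFDerivAt Dt (fderiv ℂ Dt B₀) B₀ := by
    rw [hD.fderiv]; exact hasStrictFDerivAt_Dt hC hCa hC₂ hb hHop hq hRC hDball hDfix hB₀
  have h := (hasStrictFDerivAt_id B₀).sub ((hop.mkContinuous b hHop).hasStrictFDerivAt.comp B₀ hD')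
  exact h.congr_of_eventuallyEq (Eventually.of_forall fun B => by simp)

/-- `Φ(B) = B − hD̃(B)` is complex-analytic on a neighbourhood of every point of `‖B‖ < ε`. [folklore] -/
theorem analyticOnNhd_phi (hC : QuadAnalytic Ct C₂ R) (hCa : AnalyticOnNhd ℂ Ct {Y : 𝒴 | ‖Y‖ < R})
    (hC₂ : 0 ≤ C₂) (hb : 0 ≤ b) (hHop : ∀ X, ‖hop X‖ ≤ b * ‖X‖) (hq : 9 * C₂ * b * ε < 1)
    (hRC : 3 * ε ≤ R) (hDball : ∀ B : 𝒴, ‖B‖ < ε → Dt B ∈ closedBall (0:𝒳) (4 * C₂ * ε ^ 2))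
    (hDfix : ∀ B : 𝒴, ‖B‖ < ε → Ct (B - hop (Dt B)) = Dt B) :
    AnalyticOnNhd ℂ (fun B => B - hop (Dt B)) (ball (0:𝒴) ε) := by
  intro B₀ hB₀
  have hD := analyticAt_Dt hC hCa hC₂ hb hHop hq hRC hDball hDfix (mem_ball_zero_iff.mp hB₀)
  have h := analyticAt_id.sub (((hop.mkContinuous b hHop).analyticAt (Dt B₀)).comp hD)
  exact h.congr (Eventually.of_forall fun B => by simp)

omit [CompleteSpace 𝒳] [CompleteSpace 𝒴] in
/-- The explicit inverse `Ψ(B′) = B′ + hC̃(B′)` (`B12Lineariz267` §1) is complex-analytic on `‖B′‖ < R`. [folklore] -/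
theorem analyticOnNhd_psi (hCa : AnalyticOnNhd ℂ Ct {Y : 𝒴 | ‖Y‖ < R}) (hHop : ∀ X, ‖hop X‖ ≤ b * ‖X‖) :
    AnalyticOnNhd ℂ (fun B' => B' + hop (Ct B')) {B' : 𝒴 | ‖B'‖ < R} := by
  intro B' hB'
  have h := analyticAt_id.add (((hop.mkContinuous b hHop).analyticAt (Ct B')).comp (hCa B' hB'))
  exact h.congr (Eventually.of_forall fun B => by simp)

/-- **`‖h∘DD̃(B₀)‖ ≤ 9C₂b‖B₀‖(1 − 9C₂bε)⁻¹`**: the Jacobian `DΦ(B₀) = I − h∘DD̃(B₀)` of the change of variables is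
`O(‖B₀‖)`-close to the identity. [folklore] -/
theorem norm_hop_comp_fderiv_Dt_le (hC : QuadAnalytic Ct C₂ R) (hCa : AnalyticOnNhd ℂ Ct {Y : 𝒴 | ‖Y‖ < R})
    (hC₂ : 0 ≤ C₂) (hb : 0 ≤ b) (hHop : ∀ X, ‖hop X‖ ≤ b * ‖X‖) (hq : 9 * C₂ * b * ε < 1)
    (hRC : 3 * ε ≤ R) (hDball : ∀ B : 𝒴, ‖B‖ < ε → Dt B ∈ closedBall (0:𝒳) (4 * C₂ * ε ^ 2))
    (hDfix : ∀ B : 𝒴, ‖B‖ < ε → Ct (B - hop (Dt B)) = Dt B) {B₀ : 𝒴} (hB₀ : ‖B₀‖ < ε) :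
    ‖hop.mkContinuous b hHop ∘L fderiv ℂ Dt B₀‖ ≤ 9 * C₂ * b * ‖B₀‖ * (1 - 9 * C₂ * b * ε)⁻¹ := by
  have h := norm_fderiv_Dt_le hC hCa hC₂ hb hHop hq hRC hDball hDfix hB₀
  have hq' : 0 ≤ (1 - 9 * C₂ * b * ε)⁻¹ := inv_nonneg.mpr (sub_pos.mpr hq).le
  calc ‖hop.mkContinuous b hHop ∘L fderiv ℂ Dt B₀‖ ≤ ‖hop.mkContinuous b hHop‖ * ‖fderiv ℂ Dt B₀‖ :=
        ContinuousLinearMap.opNorm_comp_le _ _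
    _ ≤ b * (9 * C₂ * ‖B₀‖ * (1 - 9 * C₂ * b * ε)⁻¹) := by
        gcongr
        exact LinearMap.mkContinuous_norm_le _ hb _
    _ = 9 * C₂ * b * ‖B₀‖ * (1 - 9 * C₂ * b * ε)⁻¹ := by ring

/-- **`DΦ(B₀) = I − h∘DD̃(B₀)` is invertible** for every `‖B₀‖ < ε` once `9C₂bε ≤ 1/2` ([15] p. 286: «for example
we take 9C₂B₀ε₃ ≦ 1/2»): then `‖h∘DD̃(B₀)‖ ≤ 9C₂b‖B₀‖(1 − 9C₂bε)⁻¹ < 9C₂bε·(1 − 9C₂bε)⁻¹ ≤ 1` and the Neumann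
series applies, with `‖DΦ(B₀)⁻¹‖ ≤ (1 − 9C₂b‖B₀‖(1 − 9C₂bε)⁻¹)⁻¹`.  (On the finite lattice this makes
`log det DΦ = Tr log(I − h∘DD̃)` of (2.12) meaningful; the trace/determinant itself is not typed here.) [folklore] -/
theorem isInvertible_fderiv_phi (hC : QuadAnalytic Ct C₂ R) (hCa : AnalyticOnNhd ℂ Ct {Y : 𝒴 | ‖Y‖ < R})
    (hC₂ : 0 ≤ C₂) (hb : 0 ≤ b) (hHop : ∀ X, ‖hop X‖ ≤ b * ‖X‖) (hq2 : 9 * C₂ * b * ε ≤ 1 / 2)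
    (hRC : 3 * ε ≤ R) (hDball : ∀ B : 𝒴, ‖B‖ < ε → Dt B ∈ closedBall (0:𝒳) (4 * C₂ * ε ^ 2))
    (hDfix : ∀ B : 𝒴, ‖B‖ < ε → Ct (B - hop (Dt B)) = Dt B) {B₀ : 𝒴} (hB₀ : ‖B₀‖ < ε) :
    (ContinuousLinearMap.id ℂ 𝒴 - hop.mkContinuous b hHop ∘L fderiv ℂ Dt B₀).IsInvertible ∧
      ‖(ContinuousLinearMap.id ℂ 𝒴 - hop.mkContinuous b hHop ∘L fderiv ℂ Dt B₀).inverse‖ ≤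
        (1 - 9 * C₂ * b * ‖B₀‖ * (1 - 9 * C₂ * b * ε)⁻¹)⁻¹ := by
  have hq : 9 * C₂ * b * ε < 1 := by linarith
  have h := norm_hop_comp_fderiv_Dt_le hC hCa hC₂ hb hHop hq hRC hDball hDfix hB₀
  have h1q : 0 < 1 - 9 * C₂ * b * ε := sub_pos.mpr hq
  have hlt : 9 * C₂ * b * ‖B₀‖ * (1 - 9 * C₂ * b * ε)⁻¹ < 1 := by
    rw [← div_eq_mul_inv, div_lt_one h1q]
    have h9 : 0 ≤ 9 * C₂ * b := by positivity
    rcases h9.eq_or_lt with h0 | hpos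
    · rw [← h0]; norm_num
    · have : 9 * C₂ * b * ‖B₀‖ < 9 * C₂ * b * ε := mul_lt_mul_of_pos_left hB₀ hpos
      linarith
  have hneg : ‖-(hop.mkContinuous b hHop ∘L fderiv ℂ Dt B₀)‖ ≤
      9 * C₂ * b * ‖B₀‖ * (1 - 9 * C₂ * b * ε)⁻¹ := by rwa [norm_neg]
  have key := isInvertible_id_add_of_norm_le hneg hlt
  rwa [← sub_eq_add_neg] at key

end implicit

/-! ## §5  The p. 267 sentence «it is an analytic function of B», assembled (transcription) -/

section transcription

variable {𝒳 𝒴 : Type*} [NormedAddCommGroup 𝒳] [NormedSpace ℂ 𝒳] [CompleteSpace 𝒳]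
  [NormedAddCommGroup 𝒴] [NormedSpace ℂ 𝒴] [CompleteSpace 𝒴]

/-- **B12 p. 267 «… there exists exactly one solution of this equation, and that it is an analytic function of
B», the JOINT-ANALYTICITY half, in the typing of this file.**  For the solution `D̃` of
`C̃(B − hD̃(B)) = D̃(B)` on `‖B‖ < ε` delivered by `B12Lineariz267.p267_linearizing_change_of_variables` (any `D̃`
with values in the ball `4C₂ε²` solving the equation), under the hypotheses there plus `C̃` analytic on `‖Y‖ < R`
and `𝒴` complete: `D̃` is complex-analytic on `‖B‖ < ε`; at every `‖B₀‖ < ε` its derivative is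
`(I + DC̃(Y₀)h)⁻¹DC̃(Y₀)` (`Y₀ = B₀ − hD̃(B₀)`, the inverse existing by the Neumann series) with
`‖DD̃(B₀)‖ ≤ 9C₂‖B₀‖(1 − 9C₂bε)⁻¹`; the change of variables `Φ(B) = B − hD̃(B)` is analytic on `‖B‖ < ε` with
`DΦ(B₀) = I − h∘DD̃(B₀)` and `‖h∘DD̃(B₀)‖ ≤ 9C₂b‖B₀‖(1 − 9C₂bε)⁻¹`.  A transcription onto Mathlib's analytic
implicit function theorem; the `Tr log`/determinant of (2.12) and the reality/𝐠-valuedness of `D̃` are NOT typed.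
[cite: Balaban1987RG1, p.267] -/
theorem p267_analytic_function_of_B {hop : 𝒳 →ₗ[ℂ] 𝒴} {Ct : 𝒴 → 𝒳} {C₂ R b ε : ℝ} {Dt : 𝒴 → 𝒳}
    (hC : B13Contraction113.QuadAnalytic Ct C₂ R) (hCa : AnalyticOnNhd ℂ Ct {Y : 𝒴 | ‖Y‖ < R})
    (hC₂ : 0 ≤ C₂) (hb : 0 ≤ b) (hHop : ∀ X, ‖hop X‖ ≤ b * ‖X‖) (hq : 9 * C₂ * b * ε < 1)
    (hRC : 3 * ε ≤ R) (hDball : ∀ B : 𝒴, ‖B‖ < ε → Dt B ∈ closedBall (0:𝒳) (4 * C₂ * ε ^ 2))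
    (hDfix : ∀ B : 𝒴, ‖B‖ < ε → Ct (B - hop (Dt B)) = Dt B) :
    AnalyticOnNhd ℂ Dt (ball (0:𝒴) ε) ∧
      (∀ B₀ : 𝒴, ‖B₀‖ < ε →
        (ContinuousLinearMap.id ℂ 𝒳 + fderiv ℂ Ct (B₀ - hop (Dt B₀)) ∘L hop.mkContinuous b hHop).IsInvertible ∧
        HasStrictFDerivAt Dt
          ((ContinuousLinearMap.id ℂ 𝒳 +
              fderiv ℂ Ct (B₀ - hop (Dt B₀)) ∘L hop.mkContinuous b hHop).inverse ∘L
            fderiv ℂ Ct (B₀ - hop (Dt B₀))) B₀ ∧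
        ‖fderiv ℂ Dt B₀‖ ≤ 9 * C₂ * ‖B₀‖ * (1 - 9 * C₂ * b * ε)⁻¹) ∧
      AnalyticOnNhd ℂ (fun B => B - hop (Dt B)) (ball (0:𝒴) ε) ∧
      (∀ B₀ : 𝒴, ‖B₀‖ < ε →
        HasStrictFDerivAt (fun B => B - hop (Dt B))
          (ContinuousLinearMap.id ℂ 𝒴 - hop.mkContinuous b hHop ∘L fderiv ℂ Dt B₀) B₀ ∧
        ‖hop.mkContinuous b hHop ∘L fderiv ℂ Dt B₀‖ ≤ 9 * C₂ * b * ‖B₀‖ * (1 - 9 * C₂ * b * ε)⁻¹) :=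
  ⟨analyticOnNhd_Dt hC hCa hC₂ hb hHop hq hRC hDball hDfix,
    fun _ hB₀ =>
      ⟨(isInvertible_id_add_fderiv_comp_hop hC hCa.differentiableOn hC₂ hb hHop hq hRC hDball hDfix hB₀).1,
        hasStrictFDerivAt_Dt hC hCa hC₂ hb hHop hq hRC hDball hDfix hB₀,
        norm_fderiv_Dt_le hC hCa hC₂ hb hHop hq hRC hDball hDfix hB₀⟩,
    analyticOnNhd_phi hC hCa hC₂ hb hHop hq hRC hDball hDfix,
    fun _ hB₀ =>
      ⟨hasStrictFDerivAt_phi hC hCa hC₂ hb hHop hq hRC hDball hDfix hB₀,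
        norm_hop_comp_fderiv_Dt_le hC hCa hC₂ hb hHop hq hRC hDball hDfix hB₀⟩⟩

/-- Non-vacuity of the hypothesis set: the degenerate model `𝒳 = 𝒴 = ℂ`, `h = id`, `C̃ = 0`, `D̃ = 0`, `C₂ = 0`,
`b = 1`, `ε = 1`, `R = 3` satisfies all nine hypotheses. [folklore] -/
example := p267_analytic_function_of_B (𝒳 := ℂ) (𝒴 := ℂ) (hop := LinearMap.id) (Ct := fun _ => 0)
  (C₂ := 0) (R := 3) (b := 1) (ε := 1) (Dt := fun _ => 0)
  ⟨fun Y _ => by simp, fun P Q => differentiableOn_const (0:ℂ)⟩ (fun Y _ => analyticAt_const) le_rfl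
  zero_le_one (fun X => by simp) (by norm_num) (by norm_num) (fun B _ => by simp) (fun B _ => by simp)

end transcription

end Literature.MathematicalPhysics.QuantumFieldTheory.Balaban1983to89.B12LinearizAnalytic267
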